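import Literature.Probability.Percolation.CardyFormula
import Literature.Probability.RandomPlanarGeometry.SelfAvoidingWalk
import Literature.Probability.Percolation.CriticalContinuity
import Literature.Probability.LatticeModels.ScalingLimit3D
import HarnessLib

/-!
# CriticalPhenomena / SAWScalingLimit — sub-problem statement (D-0017)

Moved out of `Summits/CriticalPhenomena/Statement.lean` with the declaration text unchanged.
-/

/-- Conjunct `SAWScalingLimit` of `CriticalPhenomena`: **the planar self-avoiding walk converges
to SLE_{8/3}** — for every Dobrushin domain `D = (Ω; a, b)` (bounded Jordan domain, two marked
boundary points) and every lattice approximation `a_δ, b_δ` of `a, b` joined in `Ω_δ ⊆ δℤ²`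
(`Literature.Probability.RandomPlanarGeometry.SAW.IsEndpointApprox`), the law `P_δ(γ) ∝ x_c^{|γ|}`, `x_c = 1/μ(ℤ²)`, on self-avoiding
walks of `Ω_δ` from `a_δ` to `b_δ`, pushed to curves modulo increasing reparametrisation,
converges in law as `δ → 0⁺` to chordal SLE_{8/3} in `Ω` from `a` to `b`. Lawler–Schramm–Werner
2004, §3.4.2 (existence of the scaling limit of `μ^{-|ω|}`-weighted SAW in a domain) with
Prediction 1 of §4.1 (the normalised limit is chordal SLE_{8/3}); Duminil-Copin–Smirnov 2012,
Conjecture 1 (same statement on the hexagonal lattice). The Literature statement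
`Literature.Probability.RandomPlanarGeometry.SAW.SAWScalingLimit` (`Literature/Probability/RandomPlanarGeometry/SelfAvoidingWalk.lean`),
imported not restated. [cite: LawlerSchrammWerner2004SAW, §3.4.2 and Prediction 1 (§4.1)]
[cite: DuminilCopinSmirnov2012, Conjecture 1] [problem: crit-perc] -/
abbrev SAWScalingLimit : Prop := Literature.Probability.RandomPlanarGeometry.SAW.SAWScalingLimit
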